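import Literature.NumberTheory.EllipticCurves.KubertTate289CubicShaPhi
import Literature.NumberTheory.EllipticCurves.KubertTate289CubicShaPhiHat
import Literature.NumberTheory.EllipticCurves.TwoIsogenyShaTwoTorsion
import Literature.NumberTheory.EllipticCurves.IsogenyVariableChangeProofs
import Literature.NumberTheory.EllipticCurves.SelmerCorankIsogenyProofs
import HarnessLib

/-!
# `Ш(E_{28/9}/K)[2] = 0` and `t₂(E_{28/9} ⊗ K) = 0` over the cubic `2`-division field `K = ℚ(γ)`

Topic `NumberTheory/EllipticCurves`. The two sides of the complete `2`-isogeny descent of `X = E_{A,B} ≅ E_K`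
(`E = E_{28/9} = [-19, -252, -2268, 0, 0]`, Kubert–Tate `X₁(5)`-family, rank `2`) over the cubic field
`K = ℚ(γ)`, `γ³ - γ² + 27γ + 36 = 0` (in which `E` acquires a `2`-torsion point) — `Ш(X/K)[φ] = 0`
(`KubertTate289CubicShaPhi`) and `Ш(X'/K)[φ̂] = 0` (`KubertTate289CubicShaPhiHat`, on the half-model `V₀` of `X'`
with `V₀' = X`) — are assembled (Silverman *AEC* X.4.2 with III.6.1–6.2, tree
`eq_zero_of_mem_sha_twoIsogenyCodomain_of_two_smul_eq_zero`):

* `forall_mem_sha_X_two_smul_eq_zero` — **`Ш(X/K)[2] = 0`**;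
* `shaCorank_X_two_eq_zero` — `t₂(X/K) = corank_{ℤ₂} Ш(X/K)[2^∞] = 0`;
* `shaCorank_two_baseChange_eq_zero` — **`t₂(E_{28/9} ⊗ K) = 0`** (`X = v • E_K`, isogeny invariance of the corank);
* `shaCorank_two_baseChange_adjoinRoot_eq_zero` — the same over the concrete model `K = ℚ[T]/(T³ - T² + 27T + 36)`.

Downstairs (`t₂(E_{28/9}/ℚ) = 0`, by `t_p(E/ℚ) ≤ t_p(E_K/K)`) is drawn in the Summits cell that uses it. No `L`-function,
`p`-adic or conjectural input; BSD is not touched. Theorems only.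

## References
* [SilvermanAEC2009] J. H. Silverman, *The Arithmetic of Elliptic Curves*, 2nd ed. (2009), Thm. X.4.2, Prop. X.4.9,
  III.3.1(b).
* [Greenberg1999LNM] R. Greenberg, *Iwasawa theory for elliptic curves*, LNM 1716 (1999), §1.
-/

noncomputable section

namespace Literature.NumberTheory.EllipticCurves

namespace KubertTate289Cubic

open scoped _root_.Classical _root_.NumberField
open _root_.Polynomial _root_.Module _root_.NumberField
open _root_.WeierstrassCurve _root_.WeierstrassCurve.Affine
open _root_.Literature.NumberTheory.NumberFields _root_.Literature.NumberTheory.NumberFields.MonicCubic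

variable {K : Type*} [Field K] [NumberField K] {γ : K}

/-- Transport of `Ш ∩ im Ξ = ⊥` along an equality of curves (the instances are propositions).
[cite: SilvermanAEC2009, Thm. X.4.2(a)] -/
private theorem transfer {W₁ W₂ : WeierstrassCurve K} (h : W₁ = W₂) [W₁.IsTwoTorsionNF] [W₁.IsElliptic]
    [W₂.IsTwoTorsionNF] [W₂.IsElliptic]
    (h₂ : W₂.sha ⊓ AddMonoidHom.range (G := Additive (SqUnits K)) W₂.twoIsogenyTorsorHom = ⊥) :
    W₁.sha ⊓ AddMonoidHom.range (G := Additive (SqUnits K)) W₁.twoIsogenyTorsorHom = ⊥ := by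
  subst h
  exact h₂

/-- Transport of "`Ш` has no `2`-torsion" along an equality of curves. [cite: SilvermanAEC2009, Thm. X.4.2(a)] -/
private theorem sha_two_congr {W₁ W₂ : WeierstrassCurve K} (h : W₁ = W₂)
    (h₁ : ∀ c ∈ W₁.sha, 2 • c = 0 → c = 0) : ∀ c ∈ W₂.sha, 2 • c = 0 → c = 0 := by
  subst h
  exact h₁

/-- **`Ш(X/K)[2] = 0`** for `X = E_{A,B} ≅ E_{28/9} ⊗ K` over the cubic `2`-division field: every `c ∈ Ш(X/K)` with
`2c = 0` vanishes (`Ш(V₀)[φ] = 0` and `Ш(X)[φ] = 0`, `V₀' = X`). [cite: SilvermanAEC2009, Thm. X.4.2(a)] -/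
theorem forall_mem_sha_X_two_smul_eq_zero (hγ : γ ^ 3 - γ ^ 2 + 27 * γ + 36 = 0) (h3 : finrank ℚ K = 3) :
    ∀ c ∈ (⟨0, -73 * γ ^ 2 - 155 * γ - 1238, 0, (88849 * γ ^ 2 - 562957 * γ + 1141719) / 3, 0⟩ :
      WeierstrassCurve K).sha, 2 • c = 0 → c = 0 := by
  haveI := isElliptic_X hγ
  haveI := isElliptic_halfModel hγ
  have hE' := twoIsogenyCodomain_halfModel γ
  have h₀ := sha_inf_range_twoIsogenyTorsorHom_V0_eq_bot hγ h3
  have h₁ := sha_inf_range_twoIsogenyTorsorHom_X_eq_bot hγ h3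
  exact sha_two_congr hE' fun c hc h2 ↦
    eq_zero_of_mem_sha_twoIsogenyCodomain_of_two_smul_eq_zero _ h₀ (transfer hE' h₁) hc h2

/-- **`t₂(X/K) = corank_{ℤ₂} Ш(X/K)[2^∞] = 0`.** [cite: SilvermanAEC2009, Thm. X.4.2(a)] [cite: Greenberg1999LNM, §1] -/
theorem shaCorank_X_two_eq_zero (hγ : γ ^ 3 - γ ^ 2 + 27 * γ + 36 = 0) (h3 : finrank ℚ K = 3) :
    (⟨0, -73 * γ ^ 2 - 155 * γ - 1238, 0, (88849 * γ ^ 2 - 562957 * γ + 1141719) / 3, 0⟩ :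
      WeierstrassCurve K).shaCorank 2 = 0 :=
  shaCorank_eq_zero_of_forall _ 2 (forall_mem_sha_X_two_smul_eq_zero hγ h3)

/-- **`t₂(E_{28/9} ⊗ K) = 0`** over the cubic `2`-division field (`X = v • E_K`, and the corank of `Ш[2^∞]` is an
isogeny invariant). [cite: SilvermanAEC2009, III.3.1(b)] [cite: Greenberg1999LNM, §1] -/
theorem shaCorank_two_baseChange_eq_zero (hγ : γ ^ 3 - γ ^ 2 + 27 * γ + 36 = 0) (h3 : finrank ℚ K = 3) :
    ((kubertTateFive (((28 : ℤ) : ℚ)) (((9 : ℤ) : ℚ))).baseChange K).shaCorank 2 = 0 := by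
  haveI := KubertTate289Descent.isElliptic
  haveI : ((kubertTateFive (((28 : ℤ) : ℚ)) (((9 : ℤ) : ℚ))).baseChange K).IsElliptic := by
    rw [WeierstrassCurve.baseChange]; infer_instance
  haveI := isElliptic_X hγ
  have hv : (⟨(Units.mk0 (2 : K) two_ne_zero)⁻¹, ((-73 * γ ^ 2 - 155 * γ - 591) / 12 : K), 19 / 2,
      ((-1387 * γ ^ 2 - 2945 * γ + 15987) / 24 : K)⟩ : VariableChange K) •
        (kubertTateFive (((28 : ℤ) : ℚ)) (((9 : ℤ) : ℚ))).baseChange K =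
      (⟨0, -73 * γ ^ 2 - 155 * γ - 1238, 0, (88849 * γ ^ 2 - 562957 * γ + 1141719) / 3, 0⟩ :
        WeierstrassCurve K) := by
    rw [baseChange_eq K]; exact variableChange_eq hγ
  rw [(isIsogenous_of_smul_eq hv).shaCorank_eq 2]
  exact shaCorank_X_two_eq_zero hγ h3

/-- **`t₂(E_{28/9} ⊗ K) = 0` for the model `K = ℚ[T]/(T³ - T² + 27T + 36)`** of the cubic `2`-division field.
[cite: SilvermanAEC2009, Thm. X.4.2(a)] [cite: Greenberg1999LNM, §1] -/
theorem shaCorank_two_baseChange_adjoinRoot_eq_zero :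
    haveI : Fact (Irreducible (polyQ (-1) 27 36)) := ⟨CubicField14483.irreducible_polyQ⟩
    ((kubertTateFive (((28 : ℤ) : ℚ)) (((9 : ℤ) : ℚ))).baseChange (AdjoinRoot (polyQ (-1) 27 36))).shaCorank 2 = 0 := by
  haveI : Fact (Irreducible (polyQ (-1) 27 36)) := ⟨CubicField14483.irreducible_polyQ⟩
  have hγ : (AdjoinRoot.root (polyQ (-1) 27 36)) ^ 3 - (AdjoinRoot.root (polyQ (-1) 27 36)) ^ 2 +
      27 * AdjoinRoot.root (polyQ (-1) 27 36) + 36 = 0 := by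
    have h := AdjoinRoot.eval₂_root (polyQ (-1) 27 36)
    simp only [polyQ_eq, eval₂_add, eval₂_mul, eval₂_pow, eval₂_X, eval₂_C] at h
    simp only [map_intCast] at h
    push_cast at h
    linear_combination h
  refine shaCorank_two_baseChange_eq_zero hγ ?_
  -- `finrank` over the power basis (`ℚ`-module structures on a ring are unique, so the instance paths agree)
  have h3 := PowerBasis.finrank (AdjoinRoot.powerBasis (monic_polyQ (-1) 27 36).ne_zero)
  rw [AdjoinRoot.powerBasis_dim, natDegree_polyQ] at h3
  convert h3

end KubertTate289Cubic

end Literature.NumberTheory.EllipticCurves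

end
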